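import Summits.ResolutionOfSingularities.ResolutionOfSingularities.Theses.MaxContactCut
import Summits.ResolutionOfSingularities.ResolutionOfSingularities.Theorems.ForcedTowerClasses
import Summits.ResolutionOfSingularities.ResolutionOfSingularities.Theorems.MaxContactCutTauLadder
import HarnessLib

/-!
# MaxContactCutForcedTowers — kernels of the decomp-res node «ForcedTowers» (lens-4 g7) BY NAME

Source HOME/decomp-res-lens-4/g7/ForcedTowers.lean (sha256 9d4c322bf062e089; critic `lean check` rc 0, 0 sorry,
`core_of_forced` axioms standard), CRITIC-LEDGER row 47 (2026-08-30T07:14Z): CLEARED AS ATTACK NODE (residual 0 ·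
decision 0 · map +1 · normal form +1).  The König normal form of the dim-4 core: MaxContactCut's RungOne (29273, `E
2 → E 1`, the CORE in sequence form) is attacked through `WOR n ⟺ SeqDimFour 1 n` (PROVED, `ForcedTowerClasses`) and
the EXACT-mod-ports cut `WOR n ⟸ ForcedTowersTerminate n ∧ NonIsolatedReduction n`.  Pieces = asides of
`Theses/MaxContactCut.lean` rev 9 (items 30253–30257) over `Theorems.ForcedTowerClasses` (p765120): `NoForcedTowers`
30253 [NEW OBJECT checked field-wise; WEAKER by letter; UNDECIDED; INSTRUMENTABLE T-forced-1 (folded into T-moh-3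
stage B)], `NowhereIsolatedReduction` 30254 [NECESSARY (proved, no port); WEAKER by letter (vacuous on finite top
loci = MODELS-BED-v2's 23 isolated specimens); UNDECIDED; T-forced-2], and the three excluded-middle leaves
`NoStationaryFreeTowers` [DECIDED-MOD-PORT (arc argument; HS twin proved) = cheap theorem #8],
`NoStationarySatelliteTowers` [OPEN · IDEA-NEEDED], `NoGrowingTowers` [separable ⟶ stationary mod port; inseparable
residue growth = the p-CORE, IDEA-NEEDED, barrier-adjacent]. The three PORTS `ForcedSeed n`, `ForcedDescent n`,
`TowerObstructs n` (COSTUME(cite), counted 0, re-derived TRUE-MOD- BOOKKEEPING by the critic) are HYPOTHESES of the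
kernels, never items. Kernels (all PROVED, 0 sorry): `e_one_of_forced` (ports + the two asides ⟹ `E 1`),
`rungOne_of_e_one` / `rungOne_of_forced` (29273 BY NAME), `stepDimFour_of_forced` (28011 via the costume
`SequenceToStepAll` 29274), `core_of_forced` (28544 via `MaxContactCutTauLadder.stepPICoreDimFour_of_stepDimFour`),
`pocket_of_forced` (all five booked dim-4 classes via `MaxContactCutTauLadder.closes`-shape), converses
`nowhereIsolatedReduction_of_e_one` (no port), `noForcedTowers_of_e_one` (mod `TowerObstructs`), `e_one_iff_forced`
(EXACT mod ports), and the leaf calculus `noForcedTowers_of_leaves` / `noForcedTowers_iff_leaves` (EXACT).  These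
`E`/tower statements are in SEQUENCE form and are not summit-implied — DECLARED attack pieces, as in
`Theorems/MaxContactCutTauLadder`. Why this is novel (cell-relative): no other node cuts the dim-4 core by the SHAPE
OF A MINIMAL COUNTEREXAMPLE; the forced point tower converts the existential statement into a termination statement
without choosing a resolution strategy. [BierstoneGrigorievMilmanWlodarczyk2011 §3; Hartshorne1977 II.7;
CossartJannsenSaito2020]
-/

namespace Summit.ResolutionOfSingularities.ResolutionOfSingularities.Theorems.MaxContactCutForcedTowers

open CategoryTheory AlgebraicGeometry
open Literature.AlgebraicGeometry.Resolution
open Summit.ResolutionOfSingularities.ResolutionOfSingularities.Theses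
open Summit.ResolutionOfSingularities.ResolutionOfSingularities.Theorems
open WeakOrderReduction ForcedTowerClasses

/-! ## Up: the two asides (+ ports) settle `E 1`, RungOne (29273), 28011, 28544 BY NAME -/

/-- **`E 1` from the node**: ports `ForcedSeed`, `ForcedDescent` (hypotheses) + the asides `NoForcedTowers`,
`NowhereIsolatedReduction` ⟹ weak order reduction for ALL dim-4 data (König kernel `wor_of_forced` per marking).
[folklore] -/
theorem e_one_of_forced (hS : ∀ n, 1 ≤ n → ForcedSeed n) (hD : ∀ n, 1 ≤ n → ForcedDescent n)
    (hQ : MaxContactCut.NoForcedTowers) (hN : MaxContactCut.NowhereIsolatedReduction) : E 1 :=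
  fun n hn => seqDimFour_one_of_wor (wor_of_forced (hS n hn) (hD n hn) (hQ n hn) (hN n hn))

/-- `E 1` settles RungOne (29273 BY NAME) trivially. [folklore] -/
theorem rungOne_of_e_one (h : E 1) : MaxContactCut.RungOne := fun _ => h

/-- … hence the node settles RungOne (29273). [folklore] -/
theorem rungOne_of_forced (hS : ∀ n, 1 ≤ n → ForcedSeed n) (hD : ∀ n, 1 ≤ n → ForcedDescent n)
    (hQ : MaxContactCut.NoForcedTowers) (hN : MaxContactCut.NowhereIsolatedReduction) : MaxContactCut.RungOne :=
  rungOne_of_e_one (e_one_of_forced hS hD hQ hN)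

/-- With the ladder's costume `SequenceToStepAll` (29274 BY NAME): the whole dim-4 step 28011. [folklore] -/
theorem stepDimFour_of_forced (hS : ∀ n, 1 ≤ n → ForcedSeed n) (hD : ∀ n, 1 ≤ n → ForcedDescent n)
    (hQ : MaxContactCut.NoForcedTowers) (hN : MaxContactCut.NowhereIsolatedReduction)
    (hStep : MaxContactCut.SequenceToStepAll) : MaxContactCut.StepDimFour :=
  hStep (e_one_of_forced hS hD hQ hN)

/-- … and the located dim-4 core 28544 BY NAME (landed `MaxContactCutTauLadder.stepPICoreDimFour_of_stepDimFour`).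
[folklore] -/
theorem core_of_forced (hS : ∀ n, 1 ≤ n → ForcedSeed n) (hD : ∀ n, 1 ≤ n → ForcedDescent n)
    (hQ : MaxContactCut.NoForcedTowers) (hN : MaxContactCut.NowhereIsolatedReduction)
    (hStep : MaxContactCut.SequenceToStepAll) : MaxContactCut.StepPICoreDimFour :=
  MaxContactCutTauLadder.stepPICoreDimFour_of_stepDimFour (stepDimFour_of_forced hS hD hQ hN hStep)

/-- All five booked dim-4 classes of MaxContactCut (28011, 28009, 28010, 28543, 28544) from the node, through the
landed conjunct-drop kernels BY NAME. [folklore] -/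
theorem pocket_of_forced (hS : ∀ n, 1 ≤ n → ForcedSeed n) (hD : ∀ n, 1 ≤ n → ForcedDescent n)
    (hQ : MaxContactCut.NoForcedTowers) (hN : MaxContactCut.NowhereIsolatedReduction)
    (hStep : MaxContactCut.SequenceToStepAll) :
    MaxContactCut.StepDimFour ∧ MaxContactCut.StepContactDimFour ∧ MaxContactCut.StepContactFreeDimFour ∧
      MaxContactCut.StepCFHigherDimFour ∧ MaxContactCut.StepPICoreDimFour :=
  have hD' : MaxContactCut.StepDimFour := stepDimFour_of_forced hS hD hQ hN hStep
  ⟨hD', MaxContactCutTauCut.stepContactDimFour_of_stepDimFour hD',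
    MaxContactCutTauCut.stepContactFreeDimFour_of_stepDimFour hD',
    MaxContactCutTauLadder.stepCFHigherDimFour_of_stepDimFour hD',
    MaxContactCutTauLadder.stepPICoreDimFour_of_stepDimFour hD'⟩

/-! ## Down: necessity of the asides relative to `E 1` (the cut is EXACT modulo `TowerObstructs`) -/

/-- `E 1 ⟹ NowhereIsolatedReduction` (PROVED, no port). [folklore] -/
theorem nowhereIsolatedReduction_of_e_one (h : E 1) : MaxContactCut.NowhereIsolatedReduction :=
  fun n hn => nonIsolatedReduction_of_wor (wor_of_seqDimFour_one (h n hn))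

/-- `E 1 ⟹ NoForcedTowers` modulo the counting port `TowerObstructs`. [folklore] -/
theorem noForcedTowers_of_e_one (hT : ∀ n, 1 ≤ n → TowerObstructs n) (h : E 1) : MaxContactCut.NoForcedTowers :=
  fun n hn => forcedTowersTerminate_of_wor (hT n hn) (wor_of_seqDimFour_one (h n hn))

/-- **EXACT modulo the three ports: `E 1 ⟺ NoForcedTowers ∧ NowhereIsolatedReduction`.** [folklore] -/
theorem e_one_iff_forced (hS : ∀ n, 1 ≤ n → ForcedSeed n) (hD : ∀ n, 1 ≤ n → ForcedDescent n)
    (hT : ∀ n, 1 ≤ n → TowerObstructs n) :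
    E 1 ↔ MaxContactCut.NoForcedTowers ∧ MaxContactCut.NowhereIsolatedReduction :=
  ⟨fun h => ⟨noForcedTowers_of_e_one hT h, nowhereIsolatedReduction_of_e_one h⟩,
    fun h => e_one_of_forced hS hD h.1 h.2⟩

/-- RungOne (29273) is EQUIVALENT to `E 1` given `E 2`'s provenance is irrelevant: `RungOne ∧ E 2 → E 1` and
`E 1 → RungOne` (recorded for the funnel; trivial). [folklore] -/
theorem rungOne_iff_of_e_two (h2 : E 2) : MaxContactCut.RungOne ↔ E 1 :=
  ⟨fun h => h h2, fun h _ => h⟩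

/-! ## The leaf calculus of the tower aside (excluded middle, PROVED) -/

/-- The three leaves give the tower aside. [folklore] -/
theorem noForcedTowers_of_leaves (h₁ : MaxContactCut.NoStationaryFreeTowers)
    (h₂ : MaxContactCut.NoStationarySatelliteTowers) (h₃ : MaxContactCut.NoGrowingTowers) :
    MaxContactCut.NoForcedTowers :=
  fun n hn => forcedTowersTerminate_of_leaves (h₁ n hn) (h₂ n hn) (h₃ n hn)

/-- **EXACT: `NoForcedTowers ⟺ NoStationaryFreeTowers ∧ NoStationarySatelliteTowers ∧ NoGrowingTowers`.**
[folklore] -/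
theorem noForcedTowers_iff_leaves : MaxContactCut.NoForcedTowers ↔
    MaxContactCut.NoStationaryFreeTowers ∧ MaxContactCut.NoStationarySatelliteTowers ∧
      MaxContactCut.NoGrowingTowers :=
  ⟨fun h =>
    ⟨fun n hn => ((stationaryTowersTerminate_iff n).1 ((forcedTowersTerminate_iff n).1 (h n hn)).1).1,
      fun n hn => ((stationaryTowersTerminate_iff n).1 ((forcedTowersTerminate_iff n).1 (h n hn)).1).2,
      fun n hn => ((forcedTowersTerminate_iff n).1 (h n hn)).2⟩,
    fun h => noForcedTowers_of_leaves h.1 h.2.1 h.2.2⟩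

/-- The core 28544 from the three leaves, the nowhere-isolated aside, the ports and the step costume. [folklore] -/
theorem core_of_leaves (hS : ∀ n, 1 ≤ n → ForcedSeed n) (hD : ∀ n, 1 ≤ n → ForcedDescent n)
    (h₁ : MaxContactCut.NoStationaryFreeTowers) (h₂ : MaxContactCut.NoStationarySatelliteTowers)
    (h₃ : MaxContactCut.NoGrowingTowers) (hN : MaxContactCut.NowhereIsolatedReduction)
    (hStep : MaxContactCut.SequenceToStepAll) : MaxContactCut.StepPICoreDimFour :=
  core_of_forced hS hD (noForcedTowers_of_leaves h₁ h₂ h₃) hN hStep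

end Summit.ResolutionOfSingularities.ResolutionOfSingularities.Theorems.MaxContactCutForcedTowers
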